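import Literature.Claims.NS.Guevremont2026
import HarnessLib

/-!
# C143 `Guevremont2026` — records-grade erratum: the face-diagonal velocity set is NOT fourth-order isotropic

Cell `ns-claims`, row C143 (ADJUDICATED #131: first failing step `Literature.Claims.NS.Guevremont2026.Step3_EnstrophyLaw`,
class false lemma — untouched here). The skeleton types §2.2 p.3 l.28–40 verbatim as
`Step_L2_M4iso : ∀ i j k l, M_ijkl = (1/3)(δ_ij δ_kl + δ_ik δ_jl + δ_il δ_jk)` for the fourth-order moment tensor
`M_ijkl = Σ_{a=1}^{12} w_a e_{a,i} e_{a,j} e_{a,k} e_{a,l}` of the twelve face-diagonal directions with weight `1/12`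
(the printed ground of the «Tension Tensor Lemma» §3.2 p.4 l.53–63). The same sentence prints `M_xxxx = 2/3`,
`M_xxyy = 1/3` — both correct finite sums (`M4_xxxx`, `M4_xxyy`, PROVED in the skeleton) — but the displayed
isotropic form evaluates to `1` at `(x,x,x,x)`, and ANY tensor of the isotropic shape `a(δδ + δδ + δδ)` has
`M_xxxx = 3 M_xxyy`, whereas here `M_xxxx = 2 M_xxyy`: the face-diagonal (D3Q13-type) set lacks fourth-order
isotropy. Kernel: `not_Step_L2_M4iso`. Lattice grain; not consumed by the NS chain `claim_of_steps`; records for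
the MAP's erratum column (salvage seat `ns-claims-salvage-p1` g4, lineage of the C143 salvage).

WHAT THIS IS NOT: not a claim about NS regularity or blow-up; not a claim about any author beyond the typed
locator.
-/

set_option linter.dupNamespace false

noncomputable section

namespace Summit.NavierStokesRegularity.NavierStokesRegularity.Theorems.Guevremont2026

open Literature.Claims.NS.Guevremont2026

/-- An isotropic fourth-order tensor `a(δ_ij δ_kl + δ_ik δ_jl + δ_il δ_jk)` has `xxxx`-entry three times its
`xxyy`-entry; the face-diagonal moment tensor has `M_xxxx = 2/3 = 2 · M_xxyy` instead. [cite: Guevremont2026, §2.2 p.3 l.28–40] -/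
theorem M4_xxxx_ne_three_mul_M4_xxyy : M4 0 0 0 0 ≠ 3 * M4 0 0 1 1 := by
  rw [M4_xxxx, M4_xxyy]
  norm_num

/-- **`Step_L2_M4iso` (§2.2 p.3 l.28–40, as displayed) is false**: at `(x,x,x,x)` the displayed isotropic form
gives `(1/3)·3 = 1`, while the finite sum is `M_xxxx = 2/3` (`M4_xxxx`). [cite: Guevremont2026, §2.2 p.3 l.28–40] -/
theorem not_Step_L2_M4iso : ¬ Step_L2_M4iso := by
  intro h
  have h1 := h 0 0 0 0
  rw [M4_xxxx] at h1
  simp only [kron, if_true] at h1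
  norm_num at h1

/-- FQN guard: the refuted statement is literally the skeleton's decl. [folklore] -/
example : ¬ Literature.Claims.NS.Guevremont2026.Step_L2_M4iso := not_Step_L2_M4iso

end Summit.NavierStokesRegularity.NavierStokesRegularity.Theorems.Guevremont2026

end
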